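import Mathlib.Topology.Algebra.Group.Basic
import Mathlib.Algebra.Group.Subgroup.Lattice
import HarnessLib

/-!
# Towers whose transitions are divisible by `e` modulo a sub-tower: a compatible family lies in `F_m + e^k·C_m` for every `k`,
# hence in `F_m` when `F_m` is closed and `e^k·C_m → 0` (the «depleted part dies in `lim←`» lemma)

Topic `Algebra/InverseSystem`; namespace `Literature.Algebra.InverseSystem`; currency of `AddInverseLimit.lean` (a tower of additive
commutative groups `G m` with transitions `t m : G (m+1) →+ G m`, families `x : Π m, G m` with `t m (x (m+1)) = x m`; no limit object is
formed).  The situation: sub-towers `F m ≤ C m ≤ G m` (subgroups carried into each other by the transitions) such that the transition of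
`C (m+1)` lands in `F m + e·C m` — «modulo the full part `F`, the norm of every generator of the next layer is an `e`-th power».  Then a
compatible family with `x m ∈ C m` satisfies `x m ∈ F m + e^k·C m` for EVERY `k` (induction on `k`, uniformly in `m`), and therefore
`x m ∈ F m` as soon as `F m` is closed and the `e^k`-multiples of `C m` become small (e.g. `C m` a pro-`p` group, `e = p`).  This is the
mechanism by which, in the inverse limit of Rubin's elliptic units `𝒞̄(K(𝔣p^m))` along the `p`-power tower, the units of `p`-DEPLETED
conductor (and the roots of unity) disappear: the norm from level `m+1` to level `m` of such a unit is a `p`-th power of a unit of level `m`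
(de Shalit III §1.3–1.4: `𝒞_𝔣 = lim← C̄_n` only sees conductors divisible by `p^n`).  THEOREMS ONLY (no definition, no named fact, no `sorry`).

* ★ `exists_mem_add_pow_nsmul_of_compatible` — `∀ k m, ∃ f ∈ F m, ∃ c ∈ C m, x m = f + e^k • c`;
* ★★ `mem_of_compatible_of_isClosed_of_pow_nsmul_small` — topological form: `F m` closed and `∀ U ∈ 𝓝 0, ∃ k, e^k • C m ⊆ U` ⟹ `x m ∈ F m`.

## References
* [deShalit1987] E. de Shalit, *Iwasawa theory of elliptic curves with complex multiplication* (1987), Ch. III §1.3–1.4 (p. 88–91).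
* [Washington1997] L. C. Washington, *Introduction to Cyclotomic Fields*, 2nd ed. (1997), §13.3 (inverse limits of unit groups as Λ-modules).
-/

namespace Literature.Algebra.InverseSystem

section Vanishing

variable {G : ℕ → Type*} [∀ m, AddCommGroup (G m)] (t : ∀ m, G (m + 1) →+ G m)
  (F C : ∀ m, AddSubgroup (G m)) (e : ℕ)

/-- ★ **A compatible family of a tower whose transitions are `e`-divisible modulo `F` lies in `F_m + e^k·C_m` for every `k`.**  Hypotheses: `t` carries
`F (m+1)` into `F m`, and every `t m x`, `x ∈ C (m+1)`, is `f + e • c` with `f ∈ F m`, `c ∈ C m`; `x` is compatible with `x m ∈ C m` for all `m`.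
[cite: deShalit1987, Ch. III §1.4 (p. 90–91)] -/
theorem exists_mem_add_pow_nsmul_of_compatible
    (hF : ∀ m (y : G (m + 1)), y ∈ F (m + 1) → t m y ∈ F m)
    (hC : ∀ m (y : G (m + 1)), y ∈ C (m + 1) → ∃ f ∈ F m, ∃ c ∈ C m, t m y = f + e • c)
    (x : ∀ m, G m) (hx : ∀ m, t m (x (m + 1)) = x m) (hxC : ∀ m, x m ∈ C m) :
    ∀ k m : ℕ, ∃ f ∈ F m, ∃ c ∈ C m, x m = f + (e ^ k) • c := by
  intro k
  induction k with
  | zero => exact fun m ↦ ⟨0, zero_mem _, x m, hxC m, by rw [pow_zero, one_smul, zero_add]⟩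
  | succ k ih =>
    intro m
    obtain ⟨f', hf', c', hc', e'⟩ := ih (m + 1)
    obtain ⟨f'', hf'', c'', hc'', e''⟩ := hC m c' hc'
    refine ⟨t m f' + (e ^ k) • f'', add_mem (hF m f' hf') (AddSubgroup.nsmul_mem _ hf'' _), c'', hc'', ?_⟩
    rw [← hx m, e', map_add, map_nsmul, e'', smul_add, pow_succ, mul_smul, add_assoc]

/-- ★★ **The depleted part dies in the limit**: if moreover `F m` is closed and the `e^k`-multiples of `C m` eventually enter every neighbourhood of `0`
(e.g. `C m` a compact pro-`p` group and `e = p`), then the `m`-th component of every compatible family with components in `C` lies in `F m`.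
[cite: deShalit1987, Ch. III §1.4 (p. 90–91)] [cite: Washington1997, §13.3] -/
theorem mem_of_compatible_of_isClosed_of_pow_nsmul_small [∀ m, TopologicalSpace (G m)] [∀ m, IsTopologicalAddGroup (G m)]
    (hF : ∀ m (y : G (m + 1)), y ∈ F (m + 1) → t m y ∈ F m)
    (hC : ∀ m (y : G (m + 1)), y ∈ C (m + 1) → ∃ f ∈ F m, ∃ c ∈ C m, t m y = f + e • c)
    (x : ∀ m, G m) (hx : ∀ m, t m (x (m + 1)) = x m) (hxC : ∀ m, x m ∈ C m)
    (m : ℕ) (hFc : IsClosed (F m : Set (G m)))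
    (hsmall : ∀ U ∈ nhds (0 : G m), ∃ k : ℕ, ∀ c ∈ C m, (e ^ k) • c ∈ U) :
    x m ∈ F m := by
  have key := exists_mem_add_pow_nsmul_of_compatible t F C e hF hC x hx hxC
  rw [← SetLike.mem_coe, ← hFc.closure_eq, mem_closure_iff_nhds]
  intro U hU
  -- `c ↦ x m - c` is continuous and sends `0` to `x m`, so `{c | x m - c ∈ U}` is a neighbourhood of `0`
  have hcont : Continuous fun c : G m ↦ x m - c := continuous_const.sub continuous_id
  have hU' : (fun c : G m ↦ x m - c) ⁻¹' U ∈ nhds (0 : G m) := by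
    refine hcont.continuousAt.preimage_mem_nhds ?_
    simpa only [sub_zero] using hU
  obtain ⟨k, hk⟩ := hsmall _ hU'
  obtain ⟨f, hf, c, hc, hxm⟩ := key k m
  refine ⟨f, ?_, hf⟩
  have h1 : x m - (e ^ k) • c = f := by rw [hxm, add_sub_cancel_right]
  have h2 := hk c hc
  rw [Set.mem_preimage, h1] at h2
  exact h2

end Vanishing

end Literature.Algebra.InverseSystem
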